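import Summits.Parity.GeneralizedHardyLittlewood.Theorems.ParityWeightedChenSwitchingParityChenInequalityTools
import HarnessLib

/-!
# Route `ParityWeightedChenSwitching` — crux `ParityChenInequality` (stmt-Parity-18666): the weighted sieve inequality

Chen's weighted-sieve inequality (Nathanson, *Additive Number Theory*, Thm 10.2; the tree's abstract form
`Literature.NumberTheory.Sieve.ChenSieve.weightedSieve'`) run with the PARITY WEIGHT `u(n) = (1 − μ(n))/2`
on the twin sequence `𝒜(x) = {p + 2 : 2 < p ≤ x}`: for every `x ≥ 256`, with `z = ⌈x^{1/8}⌉`,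
`y = ⌈(x+3)^{1/3}⌉`, `B(x) = chenSetB x`,

  `Φ₁(x) − ½ Φ₂(x) − ½ Φ₃(x) − y/2 − 2(x+2)/(z−1) ≤ π₂(x) = #{p ≤ x : p, p + 2 prime}`,

`Φ₁ = ∑_{n ∈ 𝒜, z-rough} u(n)`, `Φ₂ = ∑_{z ≤ q < y} ∑_{n ∈ 𝒜, q ∣ n, z-rough} u(n)`, `Φ₃ = ∑_{e ∈ B, y-rough} u(e)`
(the registered stub `stub_chenWeighted` of the crux's birth skeleton, with `phi1/phi2/phi3/pi2` unfolded).

The point (Nathanson pp. 271–273 with the weight `u`): on a `z`-rough `n ∈ 𝒜(x)` with no repeated prime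
factor, `u(n) ∈ {0, 1}`; if `u(n) = 1` then Chen's weight `1 − ½ r(n) − ½·1[n = p₁p₂p₃]` is `≤ 1[Ω(n) ≤ 2]`
(`weight_le_indicator`) and `Ω(n) ≤ 2` with `μ(n) = −1` forces `n` PRIME; if `u(n) = 0` the weight
contributes nothing. The `n` with a repeated prime factor (`u = ½`) are discarded into `(x+2)/(z−1)`
(`squareCount_le` with the full window `[z, x+3)`). The triple count is switched to `B(x)` as in
`tripleCount_twin_le`, where the primes `e ≥ y` of `B(x)` have `u(e) = 1` and are `y`-rough, so they are
counted by `Φ₃` — this is where the switched term is halved.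

References: [Nathanson1996] Thm 10.2 and §10.2; [ChenSciSinica1973] (34).
-/

namespace Summit.Parity.GeneralizedHardyLittlewood.Theorems

open Finset Filter Topology
open scoped ArithmeticFunction.Moebius ArithmeticFunction.Omega Classical
open Literature.NumberTheory.Sieve Literature.NumberTheory.Sieve.Chen
  Literature.NumberTheory.Sieve.ChenSieve

/-! ### The pointwise inequality with the parity weight -/

/-- **Pointwise parity-weighted Chen weight.** For `n ≠ 0`, `n < y³`, `n < M`, `y ≤ M`, all prime factors
of `n` at least `z`:
`u(n)(1 − ½ r(n)) − ½·1[n = p₁p₂p₃, z ≤ p₁ < y ≤ p₂ ≤ p₃] − 1[q² ∣ n for a prime z ≤ q < M] ≤ 1[n prime]`,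
`u(n) = (1 − μ(n))/2`, `r(n) = #{q ∣ n : z ≤ q < y}`. (If no `q² ∣ n` then `n` is squarefree, `u(n) ∈ {0,1}`,
and for `u(n) = 1` Nathanson's `weight_le_indicator` gives `≤ 1[Ω(n) ≤ 2]`, where `μ(n) = −1` forces
`Ω(n) = 1`.) -/
theorem parityWeight_chenWeight_le_indicator {z y M n : ℕ} (hn : n ≠ 0) (hny : n < y ^ 3) (hnM : n < M)
    (hyM : y ≤ M) (hr : IsRough z n) :
    (1 - (μ n : ℝ)) / 2 * (1 - (1 / 2) * smallFactorCount z y n) -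
        (1 / 2) * (if IsChenTriple z y n then (1 : ℝ) else 0) -
        (if HasPrimeSqFactor z M n then (1 : ℝ) else 0) ≤
      if n.Prime then (1 : ℝ) else 0 := by
  have hu0 := moebiusParityWeight_nonneg n
  have hu1 := moebiusParityWeight_le_one n
  have hr0 : (0 : ℝ) ≤ smallFactorCount z y n := Nat.cast_nonneg _
  have htri0 : (0 : ℝ) ≤ (if IsChenTriple z y n then (1 : ℝ) else 0) := by split_ifs <;> norm_num
  have hP0 : (0 : ℝ) ≤ (if n.Prime then (1 : ℝ) else 0) := by split_ifs <;> norm_num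
  -- `u (1 - r/2) ≤ u ≤ 1`
  have hA : (1 - (μ n : ℝ)) / 2 * (1 - (1 / 2) * smallFactorCount z y n) ≤ (1 - (μ n : ℝ)) / 2 := by
    have : (1 - (1 / 2) * (smallFactorCount z y n : ℝ)) ≤ 1 := by linarith
    calc _ ≤ (1 - (μ n : ℝ)) / 2 * 1 := mul_le_mul_of_nonneg_left this hu0
      _ = _ := mul_one _
  by_cases hS : HasPrimeSqFactor z M n
  · rw [if_pos hS]; linarith
  rw [if_neg hS, sub_zero]
  -- `n` is squarefree
  have hsq : Squarefree n := by
    rw [Nat.squarefree_iff_prime_squarefree]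
    intro p hp hdvd
    refine hS ⟨p, hp, ?_, ?_, ?_⟩
    · exact hr p (Nat.mem_primeFactors.mpr ⟨hp, (dvd_mul_right p p).trans hdvd, hn⟩)
    · exact lt_of_le_of_lt (Nat.le_of_dvd (Nat.pos_of_ne_zero hn) ((dvd_mul_right p p).trans hdvd)) hnM
    · rwa [pow_two]
  have hsqy : ¬ HasPrimeSqFactor z y n := fun ⟨q, hq, hzq, hqy, hdvd⟩ =>
    hS ⟨q, hq, hzq, lt_of_lt_of_le hqy hyM, hdvd⟩
  have hμ : μ n = (-1) ^ Ω n := ArithmeticFunction.moebius_apply_of_squarefree hsq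
  rcases neg_one_pow_eq_or ℤ (Ω n) with h1 | h1
  · -- `μ n = 1`, `u = 0`
    rw [hμ, h1]
    push_cast
    have : ((1 : ℝ) - 1) / 2 * (1 - 1 / 2 * (smallFactorCount z y n : ℝ)) = 0 := by ring
    rw [this]
    linarith
  · -- `μ n = -1`, `u = 1`
    rw [hμ, h1]
    push_cast
    have hW := weight_le_indicator (z := z) (y := y) hn hny hr hsqy
    have hΩP : (if Nat.IsAtMostAlmostPrime 2 n then (1 : ℝ) else 0) ≤ if n.Prime then (1 : ℝ) else 0 := by
      by_cases hap : Nat.IsAtMostAlmostPrime 2 n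
      · have hodd : Odd (Ω n) := by
          by_contra hev
          rw [Nat.not_odd_iff_even] at hev
          rw [hev.neg_one_pow] at h1
          norm_num at h1
        have h2 := hap.2
        have hΩ1 : Ω n = 1 := by obtain ⟨k, hk⟩ := hodd; omega
        rw [if_pos hap, if_pos (ArithmeticFunction.cardFactors_eq_one_iff_prime.mp hΩ1)]
      · rw [if_neg hap]; exact hP0
    have : ((1 : ℝ) - (-1)) / 2 * (1 - 1 / 2 * (smallFactorCount z y n : ℝ)) =
        1 - 1 / 2 * smallFactorCount z y n := by ring
    rw [this]
    linarith

/-! ### The switched term, the prime count, and summation -/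

/-- **The third weight and the set `B`, sharp form** (the tree's `tripleCount_twin_le` before its last
step): the elements `p + 2 = p₁p₂p₃` of `𝒜(x)` correspond to primes `p` of `B(x)`; hence
`T ≤ y + #{e ∈ B(x) : e prime, e ≥ y}`. -/
theorem tripleCount_twin_le_card_primes (x : ℕ) :
    tripleCount (twinSieveSet x) (twinZ x) (twinY x) ≤
      twinY x + #((chenSetB x).filter fun m => m.Prime ∧ twinY x ≤ m) := by
  set z := twinZ x
  set y := twinY x
  -- inject `n ↦ n - 2` into the primes of `B`
  have hinj : Set.InjOn (fun n : ℕ => n - 2) ((twinSieveSet x).filter fun n => IsChenTriple z y n) := by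
    intro a ha b hb hab
    have ha2 : 2 ≤ a := by
      obtain ⟨p, -, -, -, rfl⟩ := mem_twinSieveSet.mp (Finset.mem_filter.mp ha).1; omega
    have hb2 : 2 ≤ b := by
      obtain ⟨p, -, -, -, rfl⟩ := mem_twinSieveSet.mp (Finset.mem_filter.mp hb).1; omega
    simp only at hab
    omega
  have himage : ((twinSieveSet x).filter fun n => IsChenTriple z y n).image (fun n : ℕ => n - 2) ⊆
      (chenSetB x).filter Nat.Prime := by
    intro m hm
    rw [Finset.mem_image] at hm
    obtain ⟨n, hn, rfl⟩ := hm
    rw [Finset.mem_filter] at hn ⊢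
    obtain ⟨p, hp, -, hpx, rfl⟩ := mem_twinSieveSet.mp hn.1
    obtain ⟨p₁, p₂, p₃, h₁, h₂, h₃, hz, hy, hy', h23, heq⟩ := hn.2
    refine ⟨mem_chenSetB.mpr ⟨p₁, p₂, p₃, h₁, h₂, h₃, hz, hy, hy', h23, by omega, by omega⟩, ?_⟩
    simpa using hp
  calc tripleCount (twinSieveSet x) z y
      = #(((twinSieveSet x).filter fun n => IsChenTriple z y n).image fun n : ℕ => n - 2) := by
        rw [tripleCount, Finset.card_image_of_injOn hinj]
    _ ≤ #((chenSetB x).filter Nat.Prime) := Finset.card_le_card himage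
    _ ≤ #((chenSetB x).filter fun m => m.Prime ∧ m < y) +
          #((chenSetB x).filter fun m => m.Prime ∧ y ≤ m) := by
        rw [← Finset.card_union_of_disjoint]
        · refine Finset.card_le_card fun m hm => ?_
          rw [Finset.mem_filter] at hm
          rw [Finset.mem_union, Finset.mem_filter, Finset.mem_filter]
          by_cases h : m < y
          · exact Or.inl ⟨hm.1, hm.2, h⟩
          · exact Or.inr ⟨hm.1, hm.2, not_lt.mp h⟩
        · rw [Finset.disjoint_filter]
          intro m _ h1 h2
          omega
    _ ≤ y + #((chenSetB x).filter fun m => m.Prime ∧ y ≤ m) := by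
        gcongr
        calc #((chenSetB x).filter fun m => m.Prime ∧ m < y)
            ≤ #(Finset.range y) := by
              refine Finset.card_le_card fun m hm => ?_
              rw [Finset.mem_filter] at hm
              exact Finset.mem_range.mpr hm.2.2
          _ = y := Finset.card_range y

/-- The primes `e ≥ y` of `B(x)` are `y`-rough and carry parity weight `u(e) = 1`, so their number is at
most `Φ₃(x) = ∑_{e ∈ B(x), y-rough} (1 − μ(e))/2`. -/
theorem card_primes_chenSetB_le_paritySum (x : ℕ) :
    (#((chenSetB x).filter fun m => m.Prime ∧ twinY x ≤ m) : ℝ) ≤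
      ∑ e ∈ (chenSetB x).filter (fun e => IsRough (twinY x) e), (1 - (μ e : ℝ)) / 2 := by
  rw [Finset.card_eq_sum_ones, Nat.cast_sum]
  push_cast
  have h1 : ∑ m ∈ (chenSetB x).filter (fun m => m.Prime ∧ twinY x ≤ m), (1 : ℝ) =
      ∑ m ∈ (chenSetB x).filter (fun m => m.Prime ∧ twinY x ≤ m), (1 - (μ m : ℝ)) / 2 :=
    Finset.sum_congr rfl fun m hm => (moebiusParityWeight_prime (Finset.mem_filter.mp hm).2.1).symm
  rw [h1]
  refine Finset.sum_le_sum_of_subset_of_nonneg (fun m hm => ?_)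
    fun m _ _ => moebiusParityWeight_nonneg m
  rw [Finset.mem_filter] at hm ⊢
  refine ⟨hm.1, fun p hp => ?_⟩
  rw [Nat.mem_primeFactors] at hp
  have : p = m := (Nat.prime_dvd_prime_iff_eq hp.1 hm.2.1).mp hp.2.1
  omega

/-- The primes of `𝒜(x) = {p + 2 : 2 < p ≤ x}` are counted by `π₂(x) = #{p ≤ x : p, p + 2 prime}`. -/
theorem card_filter_prime_twinSieveSet_le (x : ℕ) :
    #((twinSieveSet x).filter Nat.Prime) ≤
      #((Finset.range (x + 1)).filter (fun p => p.Prime ∧ (p + 2).Prime)) := by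
  rw [twinSieveSet, Finset.filter_map, Finset.card_map]
  refine Finset.card_le_card fun p hp => ?_
  simp only [Finset.mem_filter, Finset.mem_Ioc, Function.comp, addRightEmbedding_apply] at hp
  rw [Finset.mem_filter, Finset.mem_range]
  exact ⟨by omega, hp.1.2, hp.2⟩

/-- `y(x) ≤ x + 3`. -/
theorem twinY_le_add_three (x : ℕ) : twinY x ≤ x + 3 := by
  rw [twinY]
  have h1 : ((x : ℝ) + 3) ^ (1 / 3 : ℝ) ≤ (x : ℝ) + 3 := by
    have h0 : (1 : ℝ) ≤ (x : ℝ) + 3 := by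
      have : (0 : ℝ) ≤ x := Nat.cast_nonneg x
      linarith
    calc ((x : ℝ) + 3) ^ (1 / 3 : ℝ) ≤ ((x : ℝ) + 3) ^ (1 : ℝ) :=
          Real.rpow_le_rpow_of_exponent_le h0 (by norm_num)
      _ = (x : ℝ) + 3 := Real.rpow_one _
  have h2 : ⌈((x : ℝ) + 3) ^ (1 / 3 : ℝ)⌉₊ ≤ ⌈((x + 3 : ℕ) : ℝ)⌉₊ :=
    Nat.ceil_le_ceil (by push_cast; exact h1)
  rwa [Nat.ceil_natCast] at h2

/-- **The weighted-sieve inequality with the parity weight** (the registered stub `stub_chenWeighted`,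
unfolded): for every `x ≥ 256`, with `z = ⌈x^{1/8}⌉`, `y = ⌈(x+3)^{1/3}⌉`, `u = (1 − μ)/2`,
`∑_{n ∈ 𝒜(x), z-rough} u(n) − ½ ∑_{z ≤ q < y} ∑_{n ∈ 𝒜(x), q ∣ n, z-rough} u(n)
  − ½ ∑_{e ∈ B(x), y-rough} u(e) − y/2 − 2(x+2)/(z−1) ≤ #{p ≤ x : p, p + 2 prime}`.
Proof: sum `parityWeight_chenWeight_le_indicator` (with `M = x + 3`) over the `z`-rough `n ∈ 𝒜(x)`;
interchange the double sum `∑_n u(n) r(n) = ∑_q ∑_{q ∣ n} u(n)`; bound the triples by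
`y + #{e ∈ B(x) prime, e ≥ y} ≤ y + Φ₃` (`tripleCount_twin_le_card_primes`,
`card_primes_chenSetB_le_paritySum`), the `n` with a repeated prime factor by `(x+2)/(z−1)`
(`squareCount_le`), and the primes of `𝒜(x)` by `π₂(x)` (`card_filter_prime_twinSieveSet_le`). -/
theorem parityMoebius_chenWeighted (x : ℕ) (hx : 256 ≤ x) :
    (∑ n ∈ (twinSieveSet x).filter (fun n => IsRough (twinZ x) n), (1 - (μ n : ℝ)) / 2) -
        (∑ q ∈ primesIco (twinZ x) (twinY x),
          ∑ n ∈ (twinSieveSet x).filter (fun n => q ∣ n ∧ IsRough (twinZ x) n), (1 - (μ n : ℝ)) / 2) / 2 -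
        (∑ e ∈ (chenSetB x).filter (fun e => IsRough (twinY x) e), (1 - (μ e : ℝ)) / 2) / 2 -
        (twinY x : ℝ) / 2 - 2 * (((x : ℝ) + 2) / ((twinZ x : ℝ) - 1)) ≤
      (((Finset.range (x + 1)).filter (fun p => p.Prime ∧ (p + 2).Prime)).card : ℝ) := by
  set A := twinSieveSet x with hAdef
  set z := twinZ x with hzdef
  set y := twinY x with hydef
  set R := A.filter (fun n => IsRough z n) with hR
  set u : ℕ → ℝ := fun n => (1 - (μ n : ℝ)) / 2 with hu
  have hz2 : 2 ≤ z := two_le_twinZ (by omega)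
  have hAM : A ⊆ Finset.Ioc 0 (x + 2) := twinSieveSet_subset_Ioc x
  have hyM : y ≤ x + 3 := twinY_le_add_three x
  have hfacts : ∀ n ∈ R, n ≠ 0 ∧ n < y ^ 3 ∧ n < x + 3 ∧ IsRough z n := fun n hn => by
    rw [hR, Finset.mem_filter] at hn
    have h1 := Finset.mem_Ioc.mp (hAM hn.1)
    have h2 := lt_twinY_pow x
    exact ⟨by omega, by rw [hydef]; omega, by omega, hn.2⟩
  -- sum the pointwise inequality over `R`
  have hsum : ∑ n ∈ R, (u n * (1 - (1 / 2) * smallFactorCount z y n) -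
      (1 / 2) * (if IsChenTriple z y n then (1 : ℝ) else 0) -
      (if HasPrimeSqFactor z (x + 3) n then (1 : ℝ) else 0)) ≤
      ∑ n ∈ R, (if n.Prime then (1 : ℝ) else 0) := by
    refine Finset.sum_le_sum fun n hn => ?_
    obtain ⟨h0, h1, h2, h3⟩ := hfacts n hn
    exact parityWeight_chenWeight_le_indicator h0 h1 h2 hyM h3
  -- the double sum `∑_n u(n) r(n) = ∑_q ∑_{q ∣ n} u(n)`
  have hdouble : ∑ n ∈ R, u n * (smallFactorCount z y n : ℝ) =
      ∑ q ∈ primesIco z y, ∑ n ∈ A.filter (fun n => q ∣ n ∧ IsRough z n), u n := by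
    have h1 : ∀ n ∈ R, u n * (smallFactorCount z y n : ℝ) =
        ∑ q ∈ primesIco z y, if q ∣ n then u n else 0 := by
      intro n hn
      rw [smallFactorCount_eq_card_filter_dvd (hfacts n hn).1, Finset.card_filter, Nat.cast_sum,
        Finset.mul_sum]
      refine Finset.sum_congr rfl fun q _ => ?_
      split_ifs <;> simp
    rw [Finset.sum_congr rfl h1, Finset.sum_comm]
    refine Finset.sum_congr rfl fun q _ => ?_
    rw [← Finset.sum_filter, hR, Finset.filter_filter]
    refine Finset.sum_congr ?_ fun _ _ => rfl
    ext n
    simp only [Finset.mem_filter]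
    tauto
  -- evaluate the left side
  have hL : ∑ n ∈ R, (u n * (1 - (1 / 2) * smallFactorCount z y n) -
      (1 / 2) * (if IsChenTriple z y n then (1 : ℝ) else 0) -
      (if HasPrimeSqFactor z (x + 3) n then (1 : ℝ) else 0)) =
      (∑ n ∈ R, u n) - (1 / 2) * (∑ q ∈ primesIco z y, ∑ n ∈ A.filter (fun n => q ∣ n ∧ IsRough z n), u n) -
        (1 / 2) * #(R.filter fun n => IsChenTriple z y n) -
          #(R.filter fun n => HasPrimeSqFactor z (x + 3) n) := by
    rw [Finset.sum_sub_distrib, Finset.sum_sub_distrib, ← Finset.mul_sum, Finset.card_filter,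
      Finset.card_filter, Nat.cast_sum, Nat.cast_sum, ← hdouble]
    simp only [Nat.cast_ite, Nat.cast_one, Nat.cast_zero]
    have : ∑ n ∈ R, u n * (1 - 1 / 2 * (smallFactorCount z y n : ℝ)) =
        ∑ n ∈ R, u n - (1 / 2) * ∑ n ∈ R, u n * (smallFactorCount z y n : ℝ) := by
      rw [Finset.mul_sum, ← Finset.sum_sub_distrib]
      exact Finset.sum_congr rfl fun n _ => by ring
    rw [this]
  have hRHS : ∑ n ∈ R, (if n.Prime then (1 : ℝ) else 0) = #(R.filter fun n => n.Prime) := by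
    rw [Finset.card_filter, Nat.cast_sum]
    simp only [Nat.cast_ite, Nat.cast_one, Nat.cast_zero]
  rw [hL, hRHS] at hsum
  -- the three restricted counts
  have h1 : (#(R.filter fun n => IsChenTriple z y n) : ℝ) ≤
      y + ∑ e ∈ (chenSetB x).filter (fun e => IsRough y e), u e := by
    have ha : #(R.filter fun n => IsChenTriple z y n) ≤ tripleCount A z y := by
      rw [tripleCount]
      exact Finset.card_le_card (Finset.monotone_filter_left _ (Finset.filter_subset _ A))
    have hb := tripleCount_twin_le_card_primes x
    have hc := card_primes_chenSetB_le_paritySum x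
    have hab : (#(R.filter fun n => IsChenTriple z y n) : ℝ) ≤
        (twinY x : ℝ) + #((chenSetB x).filter fun m => m.Prime ∧ twinY x ≤ m) := by
      exact_mod_cast ha.trans hb
    have hfin : (#(R.filter fun n => IsChenTriple z y n) : ℝ) ≤
        (twinY x : ℝ) + ∑ e ∈ (chenSetB x).filter (fun e => IsRough (twinY x) e), (1 - (μ e : ℝ)) / 2 := by
      linarith
    exact hfin
  have h2 : (#(R.filter fun n => HasPrimeSqFactor z (x + 3) n) : ℝ) ≤ ((x : ℝ) + 2) / ((z : ℝ) - 1) := by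
    have ha : #(R.filter fun n => HasPrimeSqFactor z (x + 3) n) ≤ squareCount A z (x + 3) := by
      rw [squareCount]
      exact Finset.card_le_card (Finset.monotone_filter_left _ (Finset.filter_subset _ A))
    have hb := squareCount_le (A := A) (y := x + 3) hAM hz2
    have : (#(R.filter fun n => HasPrimeSqFactor z (x + 3) n) : ℝ) ≤ (squareCount A z (x + 3) : ℝ) := by
      exact_mod_cast ha
    refine this.trans ?_
    simpa using hb
  have h3 : (#(R.filter fun n => n.Prime) : ℝ) ≤
      #((Finset.range (x + 1)).filter (fun p => p.Prime ∧ (p + 2).Prime)) := by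
    have ha : #(R.filter fun n => n.Prime) ≤ #(A.filter Nat.Prime) :=
      Finset.card_le_card (Finset.monotone_filter_left _ (Finset.filter_subset _ A))
    exact_mod_cast ha.trans (card_filter_prime_twinSieveSet_le x)
  have hJ0 : 0 ≤ ((x : ℝ) + 2) / ((z : ℝ) - 1) := by
    have : (2 : ℝ) ≤ z := by exact_mod_cast hz2
    exact div_nonneg (by positivity) (by linarith)
  change (∑ n ∈ R, u n) - (∑ q ∈ primesIco z y, ∑ n ∈ A.filter (fun n => q ∣ n ∧ IsRough z n), u n) / 2 -
    (∑ e ∈ (chenSetB x).filter (fun e => IsRough y e), u e) / 2 - (y : ℝ) / 2 -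
    2 * (((x : ℝ) + 2) / ((z : ℝ) - 1)) ≤ _
  linarith

end Summit.Parity.GeneralizedHardyLittlewood.Theorems
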